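import Summits.KontsevichZagierPeriods.KontsevichZagierPeriods.Theorems.LiouvilleUnfoldingLogPrimitiveNLStubUniformCellsAux
import Summits.KontsevichZagierPeriods.KontsevichZagierPeriods.Theorems.LiouvilleUnfoldingLogPrimitiveNLStubDescentCells
import Literature.NumberTheory.Transcendental.SemialgebraicLineDeriv
import Literature.ModelTheory.ExponentialFields.RealClosedFieldTheoryProofs
import Literature.ModelTheory.ExponentialFields.SemialgebraicInterior
import Literature.NumberTheory.Transcendental.KZLogCalculusProofs
import HarnessLib

/-!
# `LogPrimitiveNL` (stmt-KontsevichZagierPeriods-2836), line `ax-schanuel-germs`, stub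
`stub_uniformCells` — part 2: the uniform cells

The registered stub `stub_uniformCells`: for positive `ℚ`-semialgebraic `Wᵢ` (`i < k`) and further
`ℚ`-semialgebraic `Fₘ` on a `ℚ`-semialgebraic `U ⊆ ℝⁿ`, finitely many pairwise disjoint open
preconnected `ℚ`-semialgebraic cells, co-null in `U`, on which all data are `C^∞` and which are
UNIFORM for the multiplicative monomials: for every `f ∈ ℤᵏ`, either `W^f = ∏ᵢ Wᵢ ^ fᵢ` is constant
on the cell or the zero set in the cell of its log-gradient `∑ᵢ fᵢ ∂ⱼWᵢ / Wᵢ` has empty interior.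

Construction (no analyticity used): common smooth locus `U₁` (`descent_smooth_locus`); local kernel
`L x` of the log-gradient matrix `Ω j i = ∂ⱼWᵢ / Wᵢ` and its `ℚ`-semialgebraic strata
`S_d = {x ∈ U₁ | dim L x = d}` (part 1, `uniformCells_isSemialgebraic_strata`); cells = connected
components of the `interior S_d` (`descent_components`), the complement being contained in the null
set `(U \ U₁) ∪ ⋃_d (S_d \ interior S_d)`; on a cell `L` is constant
(`uniformCells_eq_of_isPreconnected`), which gives the dichotomy (`uniformCells_monomial_const` for
the first alternative).
-/

noncomputable section

open Set MeasureTheory Filter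
open scoped ContDiff Topology LaurentSeries RatFunc
open Literature.NumberTheory.Transcendental Literature.ModelTheory.ExponentialFields

namespace Summit.KontsevichZagierPeriods.LiouvilleUnfolding.LogPrimitiveNL.AxSchanuelGerms

/-! ### Monomials with vanishing log-gradient are constant on cells -/

/-- **First alternative of uniformity.** On an open preconnected `C` on which the positive `Wᵢ` are
differentiable, if the log-gradient `∑ᵢ fᵢ ∂ⱼWᵢ / Wᵢ` of the monomial `W^f = ∏ᵢ Wᵢ ^ fᵢ`
(`f ∈ ℤᵏ`) vanishes identically on `C` for every `j`, then `W^f` is constant on `C`: near each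
point `W^f = exp (∑ᵢ fᵢ log Wᵢ)`, whose partials are `W^f · ∑ᵢ fᵢ ∂ⱼWᵢ / Wᵢ = 0`, and a function
with zero gradient on a preconnected open set is constant (`descent_const_of_partials_eq_zero`).
[folklore] -/
theorem uniformCells_monomial_const {n k : ℕ} {C : Set (Fin n → ℝ)} (hCo : IsOpen C)
    (hCc : IsPreconnected C) {W : Fin k → (Fin n → ℝ) → ℝ}
    (hWd : ∀ i, ∀ x ∈ C, DifferentiableAt ℝ (W i) x) (hWpos : ∀ i, ∀ x ∈ C, 0 < W i x)
    (f : Fin k → ℤ)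
    (h0 : ∀ x ∈ C, ∀ j : Fin n,
      ∑ i, (f i : ℝ) * (fderiv ℝ (W i) x (Pi.single j 1) / W i x) = 0) :
    ∃ θ : ℝ, ∀ x ∈ C, ∏ i, W i x ^ (f i) = θ := by
  -- the monomial as the exponential of a log-linear form, on `C`
  have hexp : ∀ x ∈ C, ∏ i, W i x ^ (f i) = Real.exp (∑ i, (f i : ℝ) * Real.log (W i x)) := by
    intro x hx
    rw [Real.exp_sum]
    refine Finset.prod_congr rfl fun i _ => ?_
    rw [← Real.log_zpow, Real.exp_log (zpow_pos (hWpos i x hx) _)]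
  -- its Fréchet derivative at the points of `C`
  have hderiv : ∀ x ∈ C, HasFDerivAt (fun y => ∏ i, W i y ^ (f i))
      (Real.exp (∑ i, (f i : ℝ) * Real.log (W i x)) •
        ∑ i, (f i : ℝ) • ((W i x)⁻¹ • fderiv ℝ (W i) x)) x := by
    intro x hx
    have h1 : HasFDerivAt (fun y => ∑ i, (f i : ℝ) * Real.log (W i y))
        (∑ i, (f i : ℝ) • ((W i x)⁻¹ • fderiv ℝ (W i) x)) x :=
      HasFDerivAt.fun_sum fun i _ =>
        ((hWd i x hx).hasFDerivAt.log (hWpos i x hx).ne').const_mul (f i : ℝ)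
    refine h1.exp.congr_of_eventuallyEq ?_
    filter_upwards [hCo.mem_nhds hx] with y hy
    exact hexp y hy
  have hdiff : DifferentiableOn ℝ (fun y => ∏ i, W i y ^ (f i)) C := fun x hx =>
    (hderiv x hx).differentiableAt.differentiableWithinAt
  have hpart : ∀ j : Fin n, ∀ x ∈ C,
      fderiv ℝ (fun y => ∏ i, W i y ^ (f i)) x (Pi.single j (1 : ℝ)) = 0 := by
    intro j x hx
    rw [(hderiv x hx).fderiv]
    simp only [_root_.smul_apply, FunLike.coe_sum, Finset.sum_apply, smul_eq_mul]
    have : ∑ i, (f i : ℝ) * ((W i x)⁻¹ * fderiv ℝ (W i) x (Pi.single j 1)) = 0 := by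
      rw [← h0 x hx j]
      exact Finset.sum_congr rfl fun i _ => by rw [div_eq_inv_mul]
    rw [this, mul_zero]
  by_cases hne : C.Nonempty
  · obtain ⟨x₀, hx₀⟩ := hne
    exact ⟨_, fun x hx => descent_const_of_partials_eq_zero hCo hCc hdiff hpart hx hx₀⟩
  · exact ⟨0, fun x hx => (hne ⟨x, hx⟩).elim⟩

/-! ### The registered stub -/

/-- **Uniform cells** (registered stub `stub_uniformCells` of crux stmt-KontsevichZagierPeriods-2836,
line `ax-schanuel-germs`; replaces the card's Nash cells, no analyticity needed): for positive
`ℚ`-semialgebraic `Wᵢ` and finitely many further `ℚ`-semialgebraic functions `Fₘ` on a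
`ℚ`-semialgebraic `U ⊆ ℝⁿ` there are finitely many pairwise disjoint open preconnected
`ℚ`-semialgebraic cells `C_c ⊆ U` with `U \ ⋃ C_c` null, on which all `Wᵢ, Fₘ` are `C^∞`, such
that for every cell and EVERY integer vector `f`: either the monomial `∏ᵢ Wᵢ ^ fᵢ` is constant on
the cell, or the zero set (in the cell) of its log-gradient `∑ᵢ fᵢ ∂ⱼWᵢ / Wᵢ` (all `j`) has empty
interior. Construction: `U₁ ⊆ U` the common smooth locus (`descent_smooth_locus`); the local kernel
`L x ⊆ ℝᵏ` of the log-gradient matrix `Ω j i = ∂ⱼWᵢ / Wᵢ` (vectors killed by `Ω` on a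
neighbourhood of `x` in `U₁`); the strata `S_d = {x ∈ U₁ | dim L x = d}` are `ℚ`-semialgebraic
(`uniformCells_isSemialgebraic_strata`, Tarski–Seidenberg), `U₁ \ ⋃_d interior S_d` lies in the
null union of the `S_d \ interior S_d`; the cells are the connected components of the
`interior S_d` (`descent_components`). On a cell `L` is constant
(`uniformCells_eq_of_isPreconnected`): if `f ∈ L` the log-gradient of `W^f` vanishes on the cell
and `W^f` is constant (`uniformCells_monomial_const`); otherwise an interior point of the zero set
would put `f` into `L`. [folklore] -/
theorem stub_uniformCells :
    ∀ (n k M : ℕ) (U : Set (Fin n → ℝ)) (W : Fin k → (Fin n → ℝ) → ℝ)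
      (F : Fin M → (Fin n → ℝ) → ℝ), IsSemialgebraic ℚ U →
      (∀ i, IsSemialgebraicFunOn ℚ U (W i)) → (∀ i, ∀ x ∈ U, 0 < W i x) →
      (∀ m, IsSemialgebraicFunOn ℚ U (F m)) →
      ∃ (N : ℕ) (C : Fin N → Set (Fin n → ℝ)),
        (∀ c, IsSemialgebraic ℚ (C c) ∧ IsOpen (C c) ∧ IsPreconnected (C c) ∧ C c ⊆ U) ∧
        Pairwise (Function.onFun Disjoint C) ∧ volume (U \ ⋃ c, C c) = 0 ∧
        (∀ c i, ContDiffOn ℝ ∞ (W i) (C c)) ∧ (∀ c m, ContDiffOn ℝ ∞ (F m) (C c)) ∧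
        ∀ c (f : Fin k → ℤ),
          (∃ θ : ℝ, ∀ x ∈ C c, ∏ i, W i x ^ (f i) = θ) ∨
          interior {x ∈ C c | ∀ j : Fin n,
            ∑ i, (f i : ℝ) * (fderiv ℝ (W i) x (Pi.single j 1) / W i x) = 0} = ∅ := by
  intro n k M U W F hU hW hWpos hF
  classical
  /- Step 1: the common smooth locus `U₁` of the `k + M` functions `W i`, `F m`. -/
  obtain ⟨U₁, hU₁U, hU₁o, hU₁s, hU₁null, hsm⟩ := descent_smooth_locus hU (k + M) (Fin.append W F)
    (fun m => by
      refine Fin.addCases (fun i => ?_) (fun i => ?_) m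
      · simpa using hW i
      · simpa using hF i)
  have hWs : ∀ i, ContDiffOn ℝ ∞ (W i) U₁ := fun i => by simpa using hsm (Fin.castAdd M i)
  have hFs : ∀ m, ContDiffOn ℝ ∞ (F m) U₁ := fun m => by simpa using hsm (Fin.natAdd k m)
  have hWd : ∀ i, ∀ x ∈ U₁, DifferentiableAt ℝ (W i) x := fun i x hx =>
    ((hWs i).contDiffAt (hU₁o.mem_nhds hx)).differentiableAt (by simp)
  have hWU₁ : ∀ i, IsSemialgebraicFunOn ℚ U₁ (W i) := fun i => (hW i).mono hU₁U hU₁s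
  /- Step 2: the log-gradient matrix `Ω j i = ∂ⱼWᵢ / Wᵢ`, `ℚ`-semialgebraic on `U₁`. -/
  set Ω : Fin n → Fin k → (Fin n → ℝ) → ℝ :=
    fun j i y => fderiv ℝ (W i) y (Pi.single j 1) / W i y with hΩ_def
  have hΩ : ∀ j i, IsSemialgebraicFunOn ℚ U₁ (Ω j i) := fun j i =>
    (((hWU₁ i).fderiv_apply_single hU₁o (hWd i) j).fun_mul (hWU₁ i).fun_inv).congr
      fun x _ => (div_eq_mul_inv _ _).symm
  /- Step 3: the local kernel `L x` and its strata `S d = {x ∈ U₁ | dim L x = d}`, `d ≤ k`. -/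
  obtain ⟨L, hL⟩ := uniformCells_exists_localKernel U₁ Ω
  set S : Fin (k + 1) → Set (Fin n → ℝ) := fun d => {x | x ∈ U₁ ∧ Module.finrank ℝ (L x) = d}
    with hS_def
  have hSs : ∀ d, IsSemialgebraic ℚ (S d) := fun d => uniformCells_isSemialgebraic_strata hU₁s hΩ hL d
  have hSU₁ : ∀ d, S d ⊆ U₁ := fun d x hx => hx.1
  /- Step 4: the cells, i.e. the connected components of the `interior (S d)`. -/
  choose N Cd hCd hdisj hunion using fun d : Fin (k + 1) =>
    descent_components (isSemialgebraic_interior (hSs d)) isOpen_interior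
  obtain ⟨Nt, e, hUe, hDe⟩ := descent_reindex_fin (fun p : (Σ d : Fin (k + 1), Fin (N d)) => Cd p.1 p.2)
  have hCdU₁ : ∀ d a, Cd d a ⊆ U₁ := fun d a =>
    (hCd d a).2.2.2.2.trans (interior_subset.trans (hSU₁ d))
  refine ⟨Nt, fun c => Cd (e.symm c).1 (e.symm c).2, fun c => ?_, hDe ?_, ?_, fun c i => ?_,
    fun c m => ?_, fun c f => ?_⟩
  · -- cells: semialgebraic, open, preconnected, inside `U`
    exact ⟨(hCd _ _).1, (hCd _ _).2.1, (hCd _ _).2.2.1, (hCdU₁ _ _).trans hU₁U⟩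
  · -- pairwise disjoint
    rintro ⟨d, a⟩ ⟨d', b⟩ hne
    by_cases hdd : d = d'
    · subst hdd
      exact hdisj d fun hab => hne (congrArg (Sigma.mk d) hab)
    · refine Set.disjoint_left.2 fun x hxa hxb => hdd (Fin.ext ?_)
      have h1 : x ∈ S d := interior_subset ((hCd d a).2.2.2.2 hxa)
      have h2 : x ∈ S d' := interior_subset ((hCd d' b).2.2.2.2 hxb)
      exact h1.2.symm.trans h2.2
  · -- co-null
    have hUe' : (⋃ c, Cd (e.symm c).1 (e.symm c).2) = ⋃ p : (Σ d : Fin (k + 1), Fin (N d)),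
        Cd p.1 p.2 := hUe
    rw [hUe']
    have hcover : U \ (⋃ p : (Σ d : Fin (k + 1), Fin (N d)), Cd p.1 p.2) ⊆
        (U \ U₁) ∪ ⋃ d : Fin (k + 1), (S d \ interior (S d)) := by
      rintro x ⟨hxU, hxnot⟩
      by_cases hxU₁ : x ∈ U₁
      · refine Or.inr ?_
        have hdk : Module.finrank ℝ (L x) < k + 1 :=
          Nat.lt_succ_of_le ((Submodule.finrank_le (L x)).trans (Module.finrank_fin_fun ℝ).le)
        refine mem_iUnion.2 ⟨⟨_, hdk⟩, ⟨hxU₁, rfl⟩, fun hxint => hxnot ?_⟩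
        rw [← hunion] at hxint
        obtain ⟨a, ha⟩ := mem_iUnion.1 hxint
        exact mem_iUnion.2 ⟨⟨_, a⟩, ha⟩
      · exact Or.inl ⟨hxU, hxU₁⟩
    exact measure_mono_null hcover (measure_union_null hU₁null
      (measure_iUnion_null fun d => descent_volume_diff_interior (hSs d)))
  · -- smoothness of the `W i`
    exact (hWs i).mono (hCdU₁ _ _)
  · -- smoothness of the `F m`
    exact (hFs m).mono (hCdU₁ _ _)
  · -- uniformity
    dsimp only
    generalize e.symm c = p
    obtain ⟨d, a⟩ := p
    obtain ⟨-, hCo, hCc, -, hCV⟩ := hCd d a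
    have hCU₁ : Cd d a ⊆ U₁ := hCdU₁ d a
    have hconst : ∀ x ∈ Cd d a, ∀ y ∈ Cd d a, L x = L y := fun x hx y hy =>
      uniformCells_eq_of_isPreconnected hL hCc
        (fun z hz => (interior_subset (hCV hz) : z ∈ S d).2) hx hy
    by_cases hmem : ∀ x ∈ Cd d a, (fun i => (f i : ℝ)) ∈ L x
    · refine Or.inl (uniformCells_monomial_const hCo hCc (fun i x hx => hWd i x (hCU₁ hx))
        (fun i x hx => hWpos i x (hU₁U (hCU₁ hx))) f fun x hx j => ?_)
      obtain ⟨r, hr, h⟩ := (hL x _).1 (hmem x hx)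
      exact h x (hCU₁ hx) (by rw [dist_self]; exact hr) j
    · refine Or.inr (Set.eq_empty_iff_forall_notMem.2 fun x₀ hx₀ => hmem fun x hx => ?_)
      have hx₀C : x₀ ∈ Cd d a := (interior_subset hx₀).1
      rw [hconst x hx x₀ hx₀C]
      obtain ⟨r, hr, hball⟩ := Metric.mem_nhds_iff.1 (mem_interior_iff_mem_nhds.1 hx₀)
      exact (hL x₀ _).2 ⟨r, hr, fun y _ hy j => (hball hy).2 j⟩

end Summit.KontsevichZagierPeriods.LiouvilleUnfolding.LogPrimitiveNL.AxSchanuelGerms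

end
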